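import Summits.QuantumFields.YangMills.Theses.SmallCircleAnchor
import Summits.QuantumFields.YangMills.Theorems.SmallCircleAnchorAdiabaticContinuityStubDecompactification
import Summits.QuantumFields.YangMills.Theorems.SmallCircleAnchorEndpointTransfer

/-!
# Reducibility test for the stub `stub_thermalContinuationUniform` (crux `AdiabaticContinuity`,
# stmt-QuantumFields-11142, line `registered`, reshape r1) — SCRATCH, wave c2-w1, NOT proposed

Question put by the lead: is the registered stub statement `ThermalContinuationUniform` (A\*, Leg A
with `T'`-uniform constants; copied VERBATIM below from `Cruxes/AdiabaticContinuity/Lines/birth.lean`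
ll. 87–124) implied by the hub's EXISTING open items

* `AnchorGap`          (stmt-QuantumFields-11141, `Theses/SmallCircleAnchor.lean` l. 383) and
* `UniformLatticeGap`  (stmt-QuantumFields-8778,  `Theses/SmallCircleAnchor.lean` l. 362)?

Method: `thermalContinuationUniform_of_items` intros everything, instantiates both items at the
crux's `G, r`, `AnchorGap` at the anchor extent `T` and at the running extent `T'` (as close to the
goal as the quantifier prefixes allow), `UniformLatticeGap` at the running coupling `β`, and stops at
the first goal no instantiation closes (`sorry`, by design). The verbatim residual goal is in
`stub_thermalContinuationUniform.reduce.goal.txt`, the diagnosis in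
`stub_thermalContinuationUniform.report.md` (same directory).
-/

namespace Summit.QuantumFields.YangMills.Theorems.SmallCircleAnchor

open scoped BigOperators Topology Manifold Classical MeasureTheory ProbabilityTheory Matrix InnerProductSpace ComplexConjugate ContinuousMap
open Filter Set Function TopologicalSpace MeasureTheory

/-- **Stub A\* — thermal continuation at full deformation with `T'`-uniform constants (Leg A,
reshape r1).** For every `G, r`, abelianising `V` and anchor extent `T` there is a deformation
threshold `ε₁` such that for every schedule `E ≥ ε₁` and every `β₀`: if the anchor `(T, E(β)·V)`
clusters uniformly in `L` for all `β ≥ β₀` (`Cl (fun _ => T) (E β) β m`, definitionally the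
conclusion of `AnchorGap`), then there is `β₁` such that for every `β ≥ β₁` ONE rate `m > 0` and,
for every cube side `w`, ONE constant `C` cluster the `(T', E(β)·V)`-theory on `ℤ_{T'} × (ℤ/L)³` for
EVERY temporal extent `T' ≥ T` and every spatial size `L` (`ClAt (fun _ => T') (E β) β m w C L`).
(Ünsal–Yaffe: no transition in the circle size at fixed large deformation, arXiv:0803.0344 §5,
arXiv:0707.1869; the uniformity in `T'` is the zero-temperature end of that continuity.) -/
def ThermalContinuationUniform : Prop :=
  ∀ (G : Type) [Group G] [TopologicalSpace G] [IsTopologicalGroup G] [CompactSpace G],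
    Literature.MathematicalPhysics.QuantumFieldTheory.IsCompactSimpleLieGroup G →
    letI : MeasurableSpace G := borel G; haveI : BorelSpace G := ⟨rfl⟩;
    ∀ (r : Literature.MathematicalPhysics.QuantumFieldTheory.LatticeRep G) (V : G → ℝ),
    (Continuous V ∧ (∀ a g : G, V (a * g * a⁻¹) = V g) ∧ ∃ g₀ : G, (∀ g : G, V g₀ ≤ V g) ∧ (∀ g : G, V g = V g₀ → ∃ a : G, g = a * g₀ * a⁻¹) ∧
      (∀ a b : G, a * g₀ = g₀ * a → b * g₀ = g₀ * b → a * b = b * a)) →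
    ∀ (T : ℕ) [NeZero T],
    let ClAt := fun (τ : ℕ → ℕ) (s β m : ℝ) (w : ℕ) (C : ℝ) (L : ℕ) =>
      ∀ [NeZero L] [NeZero (τ L)],
      let St := ZMod (τ L) × (Fin 3 → ZMod L);
      let Cfg := St × Option (Fin 3) → G;
      let ν : MeasureTheory.Measure Cfg := MeasureTheory.Measure.pi fun _ => Literature.MathematicalPhysics.QuantumFieldTheory.haarProbability G;
      let sh : St → Option (Fin 3) → St := fun x μ => Option.elim μ (x.1 + 1, x.2) fun i => (x.1, x.2 + Pi.single i 1);
      let pl : Cfg → St → Option (Fin 3) → Option (Fin 3) → G := fun U x μ κ => U (x, μ) * U (sh x μ, κ) * (U (sh x κ, μ))⁻¹ * (U (x, κ))⁻¹;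
      let act : Cfg → ℝ := fun U => β * ∑ x : St, ∑ i : Fin 3, (r.ρ (pl U x none (some i))).trace.re + β * ∑ x : St, ∑ q : {q : Fin 3 × Fin 3 // q.1 < q.2}, (r.ρ (pl U x (some q.1.1) (some q.1.2))).trace.re;
      let P : Cfg → (Fin 3 → ZMod L) → G := fun U x => (List.ofFn fun t : Fin (τ L) => U ((((t : ℕ) : ZMod (τ L)), x), none)).prod;
      let wgt : Cfg → ℝ := fun U => Real.exp (act U - s * ∑ x : Fin 3 → ZMod L, V (P U x));
      let Ex : (Cfg → ℝ) → ℝ := fun F => (∫ U, F U * wgt U ∂ν) / (∫ U, wgt U ∂ν);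
      let σ : ℕ → Cfg → Cfg := fun n U p => U ((p.1.1, p.1.2 + Pi.single 0 (n : ZMod L)), p.2);
      ∀ (c : Fin 3 → ZMod L),
      let Loc := fun F : Cfg → ℝ => Measurable F ∧ (∀ U, |F U| ≤ 1) ∧ ∀ U U', (∀ p, (∀ i : Fin 3, (p.1.2 i - c i).val ≤ w) → U p = U' p) → F U = F U';
      ∀ F₁ F₂ : Cfg → ℝ, Loc F₁ → Loc F₂ → ∀ n : ℕ, 2 * n < L →
        |Ex (fun U => F₁ U * F₂ (σ n U)) - Ex F₁ * Ex (fun U => F₂ (σ n U))| ≤ C * Real.exp (-(m * n));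
    let Cl := fun (τ : ℕ → ℕ) (s β m : ℝ) => ∀ w : ℕ, ∃ C : ℝ, ∀ L : ℕ, ClAt τ s β m w C L;
    ∃ ε₁ : ℝ, ∀ E : ℝ → ℝ, (∀ β : ℝ, ε₁ ≤ E β) → ∀ β₀ : ℝ,
      (∀ β : ℝ, β₀ ≤ β → ∃ m : ℝ, 0 < m ∧ Cl (fun _ => T) (E β) β m) →
      ∃ β₁ : ℝ, ∀ β : ℝ, β₁ ≤ β → ∃ m : ℝ, 0 < m ∧
        ∀ w : ℕ, ∃ C : ℝ, ∀ (T' : ℕ), T ≤ T' → ∀ L : ℕ, ClAt (fun _ => T') (E β) β m w C L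

/-- **Reducibility test** (scratch): `AnchorGap → UniformLatticeGap → ThermalContinuationUniform`,
pushed as far as the quantifier prefixes honestly allow; the residual goal is left as `sorry`. -/
theorem thermalContinuationUniform_of_items :
    Summit.QuantumFields.YangMills.Theses.SmallCircleAnchor.AnchorGap →
    Summit.QuantumFields.YangMills.Theses.SmallCircleAnchor.UniformLatticeGap →
    ThermalContinuationUniform := by
  intro hAG hULG G _ _ _ _ hG
  letI : MeasurableSpace G := borel G
  haveI : BorelSpace G := ⟨rfl⟩
  intro r V hV T hT ClAt Cl
  -- (i) both items instantiated at the crux's `G, r`.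
  --     OBSTRUCTION (1a): `AnchorGap` hands out ITS OWN deformation `VA` (an `∃ V`), whereas the stub
  --     is about the GIVEN abelianising `V` (a `∀ V`); nothing relates `VA` to `V`.
  obtain ⟨VA, hVA, hanchA⟩ := hAG G hG r
  obtain ⟨β₀U, hU⟩ := hULG G hG r
  -- (ii) `AnchorGap` at the anchor extent `T` (threshold `0`): ITS OWN schedule `EA₀` and threshold.
  --     OBSTRUCTION (1b): the stub quantifies over EVERY schedule `E ≥ ε₁`; `EA₀` is one of them only.
  obtain ⟨EA₀, hEA₀, βA₀, hβA₀⟩ := hanchA T 0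
  -- our choices: `ε₁` is free (left as the metavariable `?ε₁`); `β₁ :=` the max of every threshold
  -- that is known BEFORE `T'` is introduced.
  refine ⟨?ε₁, fun E hE β₀ hanch => ?g1⟩
  case g1 =>
    refine ⟨max β₀ (max β₀U βA₀), fun β hβ => ?_⟩
    have hβ0 : β₀ ≤ β := (le_max_left _ _).trans hβ
    have hβU : β₀U ≤ β := (le_max_left _ _).trans ((le_max_right _ _).trans hβ)
    have hβA : βA₀ ≤ β := (le_max_right _ _).trans ((le_max_right _ _).trans hβ)
    -- the stub's own hypothesis at `β` (extent `T`, schedule `E`, deformation `V`): live, but it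
    -- speaks about the lattice `ZMod T × (ZMod L)³` only.
    obtain ⟨m₀, hm₀, hCl₀⟩ := hanch β hβ0
    -- `UniformLatticeGap` at `β`: UNDEFORMED Wilson measure on the symmetric tori `(2S+1)⁴`,
    -- `YMSpecies` (gauge-invariant cylinder) observables, the quantity `latticeConnectedCorr`.
    obtain ⟨mU, hmU, S₁, hUβ⟩ := hU β hβU
    obtain ⟨CU, hCU⟩ := hUβ r.curvature r.curvature
    -- `AnchorGap` at extent `T`, schedule `EA₀`, deformation `VA`, coupling `β`.
    obtain ⟨mA₀, hmA₀, hClA₀⟩ := hβA₀ β hβA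
    -- the rate `m` must be chosen NOW (it may depend on everything above, not on `w, T', L, …`).
    refine ⟨?m, ?hm, fun w => ?g2⟩
    case g2 =>
      obtain ⟨C₀, hC₀⟩ := hCl₀ w
      obtain ⟨CA₀, hCA₀⟩ := hClA₀ w
      -- the constant `C` must be chosen NOW (it may depend on `w`, not on `T', L, c, F₁, F₂, n`).
      refine ⟨?C, fun T' hT' L => ?g3⟩
      case g3 =>
        intro hL hτ
        have hT'0 : NeZero T' := hτ
        -- (iii) `T'` is now fixed. `AnchorGap` at extent `T'` (threshold `E β`) yields ITS OWN schedule
        --      `EA`, ITS OWN threshold `βA` — produced after `β` was fixed, so `βA ≤ β` is NOT available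
        --      (OBSTRUCTION (2a)); the closest legal instance is at the coupling `max β βA`, and its
        --      rate `mA` and constant `CA` are produced AFTER `T'` (OBSTRUCTION (2b): the stub's `?m`,
        --      `?C` were fixed before `T'`).
        obtain ⟨EA, hEA, βA, hβA'⟩ := hanchA T' (E β)
        obtain ⟨mA, hmA, hClA⟩ := hβA' (max β βA) (le_max_right _ _)
        obtain ⟨CA, hCA⟩ := hClA w
        -- right lattice `ZMod T' × (ZMod L)³`, wrong theory: coupling `max β βA`, deformation
        -- `EA (max β βA) • VA` instead of `E β • V`, constant `CA = CA(T', w)`: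
        have hA' := @hCA L hL
        -- right theory `(E β, V, β)`, wrong lattice `ZMod T × (ZMod L)³` (the stub's hypothesis):
        have h₀ := @hC₀ L hL hT
        -- `AnchorGap` at extent `T`: wrong lattice AND wrong theory:
        have hA₀ := @hCA₀ L hL
        intro St Cfg ν sh pl act P wgt Ex σ c Loc F₁ F₂ hF₁ hF₂ n hn
        -- RESIDUAL GOAL (no hypothesis in context mentions the measure `wgt` on `Cfg` built from
        -- `ZMod T'`, `E β`, `V`, `β` — harvested with `done` here, farm check 2026-08-17, the
        -- verbatim `unsolved goals` message is `…reduce.goal.txt`):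
        --   ⊢ |(Ex fun U => F₁ U * F₂ (σ n U)) - Ex F₁ * Ex fun U => F₂ (σ n U)| ≤ ?C * Real.exp (-(?m * ↑n))
        sorry
      case C => exact 1
    case m => exact 1
    case hm => exact one_pos
  case ε₁ => exact 0

end Summit.QuantumFields.YangMills.Theorems.SmallCircleAnchor
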